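import Summits.QuantumFields.BalabanUV.T4Continuum.Support.OutputRateTowerInstance
import Summits.QuantumFields.BalabanUV.T4Continuum.Spine.NE2BalabanFromNE3

/-!
# T⁴ programme — THE JUNCTION NE5 ⇐ NE2(tier B): row NE5's W1 carrier law `TowerLaw` and its END for BAŁABAN's TYPED TIER-B OPERATOR,
# the binder `hpert` (row NE5's L12) DISCHARGED by ROOT B's `PerturbationLaws` BY NAME

NE2 formalisation swarm `b2b-balaban-t4-ne2-formalise-*`, leaf prover 08 (gen 2; row B7's lineage = the producer of
`NE2BalabanFinal.perturbationLaws_balaban_final`), leaf-proposed SUPPORT item «B7 × NE5 junction» (CLAIMS.log 2026-08-20 INTENT; the NE5 owner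
t4-ne5-p1 / the NE2 owner successor / the typers may book, rename or refuse).  Row NE5's leaf table (`t4/formal/NE5/LEAVES.md` row L12) lists
the binder `hpert : ∀ j, PerturbationLaws D (P j) Jinj κ (e₂ j)` of its W1 instance (`Support/OutputRateTowerInstance`, owner t4-ne5-p1) as «row
NE2's», discharged in the tree for ONE model class only (planted potentials, `towerLaw_plantedPotential`) — «NOT Bałaban's covariant Δ_a(U),
which stays row NE2's».  This file is row NE2 delivering it for the TYPED TIER-B OPERATOR OF RECORD:
 * §1 **`towerLaw_perturbed_king_kron`** — the owner's `towerLaw_perturbed_king` on the Kronecker-lifted King tower (index `idx L M k × o`,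
   U = 1 inputs `NE2ColourPerturbedLayer.freeTowerLaws_king_kron`): for every family `P j` obeying row NE2's `PerturbationLaws` against
   `Δ_a^{(k)} ⊗ 1` with ONE `κ` and defects `C₂·L^{−k}`, and `‖t‖κ < 1`,
   `TowerLaw (fun _ => (Q_L ⊗ 1)) (pertTower (Δ_a ⊗ 1) P t) L^d (Cpert κ (2dCst) CJ C₂ 0 t) L⁻¹`.
 * §2 **`towerLaw_balaban_final_of_small`** / **`towerLaw_balaban_final_of_regular`** — for a FAMILY `Rg : Jx → (k ↦ R_k)` of site-based
   colour-transporter towers (DATA — no assertion that `Rg j` is the (3.35)-gauge transporter tower of a minimiser, trigger c5) in row B5's class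
   with COMMON sizes `α, β`, node NE3's `LocalRate` BY NAME per member (OPEN, displayed), `a′ > 0` and the numeric binders of
   `NE2BalabanFinal.balaban_final_rate_of_small` (resp. `α, β ≤ η ≤ etaStar o d a a′` of `NE2BalabanThreshold`): the W1 law at the physical coupling
   `t = 1` for `P j := balabanPert (liftR (Rg j)) (gaugeSlot (Rg j) (QuT (siteT (Rg j))) Q1 a′)` — `hpert j := perturbationLaws_balaban_final` BY NAME,
   `‖1‖·κ < 1` by leaf-03's `kappaBs_balaban_le_of_small`.  ONE constant, ONE rate for the whole family.
 * §3 **`ne5_at_of_balaban_lip_readsIns_nat`** — row NE5's END face `OutputRateTowerSocket.ne5_at_of_towerLaw_lip_readsIns_nat` with W1 := §2;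
   every other binder of that face (the reading `ReadsTower`, the floor, MI-R, W2, W2-ins, W3, `ReadsIns`, R, S) passed through VERBATIM.
 * §4 **`towerLaw_balaban_final_of_minActReadings`** — the family indexed by the ADMISSIBLE DATA `↥dom` of node NE3's own carrier: ONE binder
   `hNE3 : LocalRate (MinimalActionRate.minActReadings d 𝒞 L N dom (ne2Loc L M (liftR ∘ Rg))) C θ` (`θ ≤ L⁻¹`; row B6′'s
   `NE2BalabanFromNE3.localRate_regClass_of_minActReadings`) replaces the per-member `hNE3` — the chain NE5(W1) ⇐ NE2(tier B) ⇐ NE3(carrier) BY NAME.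
 * §5 **`operatorRate_of_balaban_split_minActReadings`** — the socket's «W1 = NE2 ∧ NE3, BOTH BY NAME» face (`operatorRate_of_towerLaw_split`, the
   minimiser split) for Bałaban's typed operator with BOTH legs fed by THE SAME hypothesis: `hNE3 : LocalRate (minActReadings … (ne2Loc …)) C L⁻¹`
   is the W1 leg's NE3-type input (through §4) AND the second leg's `hR` (the readings carrier of the split IS NE3's carrier with the NE2 reading);
   conclusion `Mdl.OperatorRate W (cR·Cpert(κ_B, …, 1)/r₀ + Λb·C) L⁻¹`.
So the DAG edge NE5 ⇐ NE2(tier B) is BY NAME at the W1 socket for the operator of record, and through row B6′ the NE3-type binder is node U1b's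
`LocalRate` on NE3's own carrier.

HONEST FRAMING (T4-DAG p. 1).  Junction bookkeeping (two applications of landed theorems + one threshold inequality); `Rg` DATA (no B0); `hreg`,
`hNE3` (node NE3, OPEN) and the smallness DISPLAYED per member; nothing of W2/W3/O2-op/the step model of record is touched; NE5 NOT proved, NE2
NOT proved (c1 with the carver), NE3 NOT proved; MODEL LEVEL, GLOBAL small field, finite torus, linear layer, operator norm; spine PROVED 0/9
unchanged; NOT infinite volume / mass gap / Clay.  HONEST DEPENDENCY: continuum YM on T⁴ ⇐ BetaPertH ∧ nine spine estimates (0/9 proved); BetaPertH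
⇐ (D1) ∧ (D4) ∧ CAP+tail; G-an2-4 gates asym, D1 and NE2/3/4.  ABSOLUTE RULE kept; no `def … : Prop` fact; no new definition; no `sorry`.
-/

noncomputable section

open scoped BigOperators ComplexConjugate Matrix Matrix.Norms.L2Operator Kronecker

namespace Summit.QuantumFields.BalabanUV.T4Continuum.OutputRateTowerBalaban

open Literature.MathematicalPhysics.QuantumFieldTheory.Balaban1983to89
open Literature.MathematicalPhysics.QuantumFieldTheory.Balaban1983to89.B5Prop11Plancherel (Cst Cst_nonneg Tor fine)
open Literature.MathematicalPhysics.QuantumFieldTheory.Balaban1983to89.B5G183RateUnitTower (lev lev_neZero)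
open Literature.MathematicalPhysics.QuantumFieldTheory.Balaban1983to89.T4OutputRate
open Literature.MathematicalPhysics.QuantumFieldTheory.Balaban1983to89.T4InputCauchyRateData
open Literature.MathematicalPhysics.QuantumFieldTheory.Balaban1983to89.T4OperatorRateLiaison
open Literature.MathematicalPhysics.QuantumFieldTheory.Balaban1983to89.T4EtaRateMin (LocalRate)
open Summit.QuantumFields.BalabanUV.T4Continuum
open Summit.QuantumFields.BalabanUV.T4Continuum.CovariantAveragingTower
open Summit.QuantumFields.BalabanUV.T4Continuum.BackgroundResolventTower
open Summit.QuantumFields.BalabanUV.T4Continuum.OutputRateInsertion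
open Summit.QuantumFields.BalabanUV.T4Continuum.OutputRateTowerSocket
open Summit.QuantumFields.BalabanUV.T4Continuum.OutputRateTowerInstance
open Summit.QuantumFields.BalabanUV.T4Continuum.BalabanAveragedTowerUnit (idx Qlev)
open Summit.QuantumFields.BalabanUV.T4Continuum.KingPairingPlantedLaw (calDalev JpcT CJ CJ_nonneg)
open Summit.QuantumFields.BalabanUV.T4Continuum.GramPerturbationLaw (C2gram)
open Summit.QuantumFields.BalabanUV.T4Continuum.NE2FromNE3 (bgReadings)
open Summit.QuantumFields.BalabanUV.T4Continuum.NE2ColourPerturbedLayer (freeTowerLaws_king_kron)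
open Summit.QuantumFields.BalabanUV.T4Continuum.CovariantAveragingSummand (kappaQ kappaQ_ofReal)
open Summit.QuantumFields.BalabanUV.T4Continuum.RegularBackgroundTower (RegularTransporters regClass betaNE3)
open Summit.QuantumFields.BalabanUV.T4Continuum.GaugeTermPerturbationLaw (deltaK)
open Summit.QuantumFields.BalabanUV.T4Continuum.GaugeTermScalarData (QuT Q1)
open Summit.QuantumFields.BalabanUV.T4Continuum.GaugeTermInstanceGeom (gS)
open Summit.QuantumFields.BalabanUV.T4Continuum.ScalarAveragedCompression (sigma0)
open Summit.QuantumFields.BalabanUV.T4Continuum.ScalarCovariantLaplacian (kappaS)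
open Summit.QuantumFields.BalabanUV.T4Continuum.RegularSiteTransporters (siteT)
open Summit.QuantumFields.BalabanUV.T4Continuum.NestedContourTransport (theta0)
open Summit.QuantumFields.BalabanUV.T4Continuum.NE2BalabanRoot (balabanPert)
open Summit.QuantumFields.BalabanUV.T4Continuum.NE2BalabanGauge (gaugeSlot liftR)
open Summit.QuantumFields.BalabanUV.T4Continuum.NE2BalabanLayerSharp (kappaBs C2Bs KstarR kappaBs_balaban_le_of_small)
open Summit.QuantumFields.BalabanUV.T4Continuum.NE2BalabanWiring (epsR CdeltaR epsR_nonneg)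
open Summit.QuantumFields.BalabanUV.T4Continuum.NE2BalabanFinal (tauR kappa4F C4F perturbationLaws_balaban_final)
open Summit.QuantumFields.BalabanUV.T4Continuum.NE2BalabanThreshold (etaStar smallness_of_le)
open Summit.QuantumFields.BalabanUV.T4Continuum.NE2FromNE3Carrier (ne2Loc)
open Summit.QuantumFields.BalabanUV.T4Continuum.NE2BalabanFromNE3 (localRate_regClass_of_minActReadings)
open Summit.QuantumFields.BalabanUV.T4Continuum.MinimalActionRate (minActReadings)

variable {d : ℕ} (L : ℕ) [NeZero L] (M : Fin d → ℕ) [hM : ∀ μ, NeZero (M μ)] (a : ℝ) (ha : 0 < a)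
variable {o : Type*} [Fintype o] [DecidableEq o]

/-! ## §1 The W1 law for perturbed towers over the Kronecker-lifted King tower -/

/-- **`TowerLaw` FOR THE KING-AVERAGED PERTURBED TOWERS OVER `Δ_a ⊗ 1`** (the owner's `towerLaw_perturbed_king` on the colour-lifted index
`idx L M k × o`): for every family of perturbations `P j` of `Δ_a^{(k)} ⊗ 1` obeying row NE2's `PerturbationLaws` with ONE `κ` and consistency
defects `C₂·L^{−k}`, and every `‖t‖κ < 1`: `TowerLaw (fun _ => (Q_L ⊗ 1)) (pertTower (Δ_a ⊗ 1) P t) L^d (Cpert κ (2dCst) CJ C₂ 0 t) L⁻¹` — the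
U = 1 inputs are row NE2's THEOREM `freeTowerLaws_king_kron`; the one binder of NE2 type is `hpert`. [folklore] -/
theorem towerLaw_perturbed_king_kron {Jx : Type*} {P : Jx → (k : ℕ) → Matrix (idx L M k × o) (idx L M k × o) ℂ} {κ C₂ : ℝ}
    (hpert : ∀ j, PerturbationLaws (fun k => calDalev L M a ha k ⊗ₖ (1 : Matrix o o ℂ)) (P j)
      (fun k => JpcT L M k ⊗ₖ (1 : Matrix o o ℂ)) κ (fun k => C₂ * ((L : ℝ)⁻¹) ^ k)) {t : ℂ} (ht : ‖t‖ * κ < 1) :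
    TowerLaw (fun _ : Jx => fun k => Qlev L M k ⊗ₖ (1 : Matrix o o ℂ))
      (pertTower (fun k => calDalev L M a ha k ⊗ₖ (1 : Matrix o o ℂ)) P t) ((L : ℝ) ^ d)
      (Cpert κ (2 * d * Cst d a) (CJ d a) C₂ 0 t) ((L : ℝ)⁻¹) := by
  have hr : (0 : ℝ) < (L : ℝ) ^ d := pow_pos (by exact_mod_cast Nat.pos_of_ne_zero (NeZero.ne L)) d
  exact towerLaw_perturbed hr (freeTowerLaws_king_kron L M a ha o) hpert (fun _ => le_rfl) (fun _ => le_rfl) (fun _ _ => le_rfl)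
    (fun _ => by simp) ht

/-! ## §2 The W1 law for Bałaban's typed tier-B operator, `hpert` discharged by ROOT B's `PerturbationLaws` -/

section Balaban

variable {Jx : Type*} {Rg : Jx → ((k : ℕ) → Fin d → (Tor (fine (lev L k) M) → Matrix o o ℂ))} {α β C a' η : ℝ}

omit [NeZero L] hM [DecidableEq o] in
/-- the Neumann-disc condition at the physical coupling `t = 1` from the numeric thresholds: `‖1‖·κ_B < 1` (leaf-03's
`kappaBs_balaban_le_of_small`). [folklore] -/
theorem norm_one_mul_kappaBs_lt_one (ha0 : 0 ≤ a) (hα : 0 ≤ α) (hαη : α ≤ η) (hβη : β ≤ η) (hεη : epsR o d α ≤ η) (hκη : kappa4F d a a' α β ≤ η)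
    (hη1 : η ≤ 1) (hηK : η * KstarR o d a < 1) :
    ‖(1 : ℂ)‖ * kappaBs o d a α β (a * (epsR o d α * (2 + epsR o d α) * Cst d a)) (kappa4F d a a' α β) < 1 := by
  rw [norm_one, one_mul]
  exact (kappaBs_balaban_le_of_small a ha0 hα (epsR_nonneg (o := o) (d := d) hα) hαη hβη hεη hκη hη1).trans_lt hηK

omit [NeZero L] hM [DecidableEq o] in
/-- the same under the one explicit threshold `α, β ≤ η ≤ etaStar o d a a′` (smallness parameter `η·Kmax`). [folklore] -/
theorem norm_one_mul_kappaBs_lt_one_of_regular (ha0 : 0 ≤ a) (ha' : 0 < a') (hα : 0 ≤ α) (hβ : 0 ≤ β) (hαη : α ≤ η) (hβη : β ≤ η)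
    (hη : η ≤ etaStar o d a a') :
    ‖(1 : ℂ)‖ * kappaBs o d a α β (a * (epsR o d α * (2 + epsR o d α) * Cst d a)) (kappa4F d a a' α β) < 1 := by
  obtain ⟨-, -, h3, h4, h5, h6, h7, h8⟩ := smallness_of_le (o := o) (d := d) a ha0 ha' hα hβ hαη hβη hη
  exact norm_one_mul_kappaBs_lt_one a ha0 hα h3 h4 h5 h6 h7 h8

/-- **ROW NE5's W1 LAW FOR BAŁABAN's TYPED TIER-B OPERATOR, NUMERIC-THRESHOLD FORM** (`d ≥ 1`): for a family `Rg j` of site-based transporter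
towers (DATA) in row B5's (3.35)-shape class with common sizes `α, β`, node NE3's `LocalRate … C L⁻¹` BY NAME for every member (OPEN), `a′ > 0`,
and the numeric binders of `NE2BalabanFinal.balaban_final_rate_of_small`:
`TowerLaw (fun _ => (Q_L ⊗ 1)) (pertTower (Δ_a ⊗ 1) (fun j => balabanPert (liftR (Rg j)) (gaugeSlot (Rg j) …) ) 1) L^d (Cpert κ_B (2dCst) CJ C₂^B 0 1) L⁻¹`
— `hpert j := perturbationLaws_balaban_final` (row B7) BY NAME, `‖1‖κ_B < 1` by `kappaBs_balaban_le_of_small` (leaf-03).  Row NE5's L12 binder for the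
operator of record; NE5 / NE2 / NE3 NOT proved. [folklore] -/
theorem towerLaw_balaban_final_of_small (hd : 1 ≤ d) (hreg : ∀ j, RegularTransporters L M (liftR L M (Rg j)) α β) (hC : 0 ≤ C)
    (hNE3 : ∀ j, LocalRate (bgReadings L M (regClass L M (liftR L M (Rg j)))) C ((L : ℝ)⁻¹)) (ha' : 0 < a')
    (hκ : kappaS d a' α β (tauR d α) < 1)
    (hsmall : ((sigma0 d a') ^ 2)⁻¹ * deltaK (gS d a' (kappaS d a' α β (tauR d α))) (1 + tauR d α) (d * α) (tauR d α) a' < 1)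
    (hα : 0 ≤ α) (hαη : α ≤ η) (hβη : β ≤ η) (hεη : epsR o d α ≤ η) (hκη : kappa4F d a a' α β ≤ η) (hη1 : η ≤ 1)
    (hηK : η * KstarR o d a < 1) :
    TowerLaw (fun _ : Jx => fun k => Qlev L M k ⊗ₖ (1 : Matrix o o ℂ))
      (pertTower (fun k => calDalev L M a ha k ⊗ₖ (1 : Matrix o o ℂ))
        (fun j => balabanPert L M a (liftR L M (Rg j)) (gaugeSlot L M (Rg j) (QuT L M o (siteT L M (Rg j))) (Q1 L M o) a')) 1)
      ((L : ℝ) ^ d)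
      (Cpert (kappaBs o d a α β (a * (epsR o d α * (2 + epsR o d α) * Cst d a)) (kappa4F d a a' α β))
        (2 * d * Cst d a) (CJ d a)
        (C2Bs o d L a α β C
          (a * C2gram (Cst d a) 1 (epsR o d α) (2 * d * Cst d a) (CJ d a) (Cst d a) (CdeltaR o d a α (theta0 d α (betaNE3 o C))))
          (C4F o d L a a' α β C)) 0 1) ((L : ℝ)⁻¹) := by
  refine towerLaw_perturbed_king_kron L M a ha (fun j => ?_) (norm_one_mul_kappaBs_lt_one a ha.le hα hαη hβη hεη hκη hη1 hηK)
  have h := perturbationLaws_balaban_final L M a ha hd (hreg j) hC (hNE3 j) ha' hκ hsmall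
  rwa [kappaQ_ofReal ha.le] at h

/-- **ROW NE5's W1 LAW FOR BAŁABAN's TYPED TIER-B OPERATOR UNDER THE ONE EXPLICIT THRESHOLD** (`d ≥ 1`, `a ≥ 0` via `0 < a`): the same with the
numeric binders replaced by `α ≤ η`, `β ≤ η`, `η ≤ etaStar o d a a′` (`NE2BalabanThreshold.smallness_of_le`), the W1 constant being read at the
smallness parameter `η·Kmax`. [folklore] -/
theorem towerLaw_balaban_final_of_regular (hd : 1 ≤ d) (hreg : ∀ j, RegularTransporters L M (liftR L M (Rg j)) α β) (hα : 0 ≤ α)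
    (hβ : 0 ≤ β) (hC : 0 ≤ C) (hNE3 : ∀ j, LocalRate (bgReadings L M (regClass L M (liftR L M (Rg j)))) C ((L : ℝ)⁻¹)) (ha' : 0 < a')
    (hαη : α ≤ η) (hβη : β ≤ η) (hη : η ≤ etaStar o d a a') :
    TowerLaw (fun _ : Jx => fun k => Qlev L M k ⊗ₖ (1 : Matrix o o ℂ))
      (pertTower (fun k => calDalev L M a ha k ⊗ₖ (1 : Matrix o o ℂ))
        (fun j => balabanPert L M a (liftR L M (Rg j)) (gaugeSlot L M (Rg j) (QuT L M o (siteT L M (Rg j))) (Q1 L M o) a')) 1)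
      ((L : ℝ) ^ d)
      (Cpert (kappaBs o d a α β (a * (epsR o d α * (2 + epsR o d α) * Cst d a)) (kappa4F d a a' α β))
        (2 * d * Cst d a) (CJ d a)
        (C2Bs o d L a α β C
          (a * C2gram (Cst d a) 1 (epsR o d α) (2 * d * Cst d a) (CJ d a) (Cst d a) (CdeltaR o d a α (theta0 d α (betaNE3 o C))))
          (C4F o d L a a' α β C)) 0 1) ((L : ℝ)⁻¹) := by
  obtain ⟨h1, h2, h3, h4, h5, h6, h7, h8⟩ := smallness_of_le (o := o) (d := d) a ha.le ha' hα hβ hαη hβη hη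
  exact towerLaw_balaban_final_of_small L M a ha hd hreg hC hNE3 ha' h1 h2 hα h3 h4 h5 h6 h7 h8

end Balaban

/-! ## §3 Row NE5's END for Bałaban's typed tier-B operator -/

section EndFace

variable {Jx : Type*} {Rg : Jx → ((k : ℕ) → Fin d → (Tor (fine (lev L k) M) → Matrix o o ℂ))} {α β C a' η : ℝ}
variable {Cr : Carriers} {Op Hist : Type*} [NormedAddCommGroup Op] [NormedSpace ℂ Op] [NormedAddCommGroup Hist]
  [NormedSpace ℂ Hist] [CompleteSpace Hist] (Mdl : StepModel Cr Op Hist)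

/-- **ROW NE5's END FOR BAŁABAN's TYPED TIER-B OPERATOR — THE BINDER OF NE2 TYPE DISCHARGED BY ROOT B.**  For operator species an instantiation
reads (`ReadsTower`, constant `cR`) from the lifted King-averaged towers of `(Δ_a^{(k)} ⊗ 1 + P_k(Rg j))⁻¹`, `P(Rg j)` the typed tier-B perturbation
(covariant Laplacian + Bałaban's covariant line-sum averaging + gauge term) of the member `Rg j` of a family of site-based transporter towers (DATA)
(a nonempty family, `hJ`) in row B5's class with common sizes `α, β ≤ η ≤ etaStar o d a a′`, node NE3's `LocalRate … C L⁻¹` per member (OPEN,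
displayed), `a′ > 0`: NE5
follows from the reading, the [I]-type floor, MI-R, W2, W2-ins (+ `InsBoundA`), W3, `ReadsIns`, R, S — the owner's END face
`ne5_at_of_towerLaw_lip_readsIns_nat` with W1 := `towerLaw_balaban_final_of_regular`, constant `δ = cR·Cpert(κ_B, 2dCst, CJ, C₂^B, 0, 1)/r₀`,
rate `L^{−1}`.  Model level (no B0); NE5 / NE2 / NE3 NOT proved. [folklore] -/
theorem ne5_at_of_balaban_lip_readsIns_nat (Ins : ℕ → Op → (Cr.Dom → ℝ) → Hist) (hJ : Nonempty Jx) (hd : 1 ≤ d)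
    (hreg : ∀ j, RegularTransporters L M (liftR L M (Rg j)) α β) (hα : 0 ≤ α) (hβ : 0 ≤ β) (hC : 0 ≤ C)
    (hNE3 : ∀ j, LocalRate (bgReadings L M (regClass L M (liftR L M (Rg j)))) C ((L : ℝ)⁻¹)) (ha' : 0 < a')
    (hαη : α ≤ η) (hβη : β ≤ η) (hη : η ≤ etaStar o d a a')
    {W : Set (ℕ → ℝ)} {cR r₀ δ : ℝ} {tow : ℕ → (ℕ → ℝ) → Cr.BgB → Jx} {EA : Functional Cr Cr.BgA} {EB : Functional Cr Cr.BgB}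
    {κ Λ EA₀ E₀ Gi θ' c ω ρ₀ ρ₁ Bc : ℝ} {k₀ k₁ : ℕ}
    (hread : ReadsTower Mdl (fun _ : Jx => fun k => Qlev L M k ⊗ₖ (1 : Matrix o o ℂ))
      (pertTower (fun k => calDalev L M a ha k ⊗ₖ (1 : Matrix o o ℂ))
        (fun j => balabanPert L M a (liftR L M (Rg j)) (gaugeSlot L M (Rg j) (QuT L M o (siteT L M (Rg j))) (Q1 L M o) a')) 1)
      ((L : ℝ) ^ d) W cR tow)
    (hcR : 0 ≤ cR) (hfl : ∀ k, r₀ ≤ Mdl.rOp k) (hr₀ : 0 < r₀)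
    (hδ : cR * Cpert (kappaBs o d a α β (a * (epsR o d α * (2 + epsR o d α) * Cst d a)) (kappa4F d a a' α β))
        (2 * d * Cst d a) (CJ d a)
        (C2Bs o d L a α β C
          (a * C2gram (Cst d a) 1 (epsR o d α) (2 * d * Cst d a) (CJ d a) (Cst d a) (CdeltaR o d a α (theta0 d α (betaNE3 o C))))
          (C4F o d L a a' α β C)) 0 1 / r₀ = δ)
    (hrA : Mdl.RepresentsA EA W) (hrB : Mdl.RepresentsB EB W) (hbase : Mdl.InBase EB W) (hlip : Mdl.DataLipschitz W κ Λ ρ₀)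
    (hdA : DecayBound EA W EA₀ κ) (hdB : DecayBound EB W E₀ κ) (hreadI : (InsOpModel.ofStep Mdl Ins).ReadsIns W)
    (hienv : (InsOpModel.ofStep Mdl Ins).InsOpEnvelope W κ E₀ Gi) (hbdA : (InsOpModel.ofStep Mdl Ins).InsBoundA W κ E₀ Gi)
    (hGi : 0 ≤ Gi) (hρ₁ : ρ₁ < 1) (hreach : δ * ((L : ℝ)⁻¹) ^ k₁ ≤ ρ₁) (hdamp : Mdl.InsertionDampedNat W κ c ω) (hΛ : 0 ≤ Λ)
    (hθθ' : (L : ℝ)⁻¹ ≤ θ') (hθ'1 : θ' ≤ 1) (hc : 0 ≤ c) (hω : 0 < ω)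
    (hnear : (δ + (Gi * δ / (1 - ρ₁) + 2 * Gi / ((L : ℝ)⁻¹) ^ k₁)) * ((L : ℝ)⁻¹) ^ k₀ + c * (EA₀ + E₀) / (1 - ω) ≤ ρ₀)
    (hBc : 0 ≤ Bc) (hfirst : ∀ k < k₀, EA₀ + E₀ ≤ Bc * ((L : ℝ)⁻¹) ^ k) (hsmall : ω + Λ * c < θ') :
    NE5 EA EB W κ θ'
      ((Λ * (δ + (Gi * δ / (1 - ρ₁) + 2 * Gi / ((L : ℝ)⁻¹) ^ k₁)) + Bc) * (θ' - ω) / (θ' - (ω + Λ * c))) := by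
  have hL : (0 : ℝ) < L := by exact_mod_cast Nat.pos_of_ne_zero (NeZero.ne L)
  have hr : (0 : ℝ) < (L : ℝ) ^ d := pow_pos hL d
  have hlaw := towerLaw_balaban_final_of_regular L M a ha hd hreg hα hβ hC hNE3 ha' hαη hβη hη
  -- `0 ≤ Cpert …` at `t = 1`: `‖1‖κ_B < 1` from the threshold; `0 ≤ C₂^B` read off the law's consistency clause at `k = 0` for a member
  have ht := norm_one_mul_kappaBs_lt_one_of_regular (o := o) (d := d) a ha.le ha' hα hβ hαη hβη hη
  have hC₀ : (0 : ℝ) ≤ 2 * d * Cst d a := by have := Cst_nonneg d a; positivity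
  have hC₂ : 0 ≤ C2Bs o d L a α β C
      (a * C2gram (Cst d a) 1 (epsR o d α) (2 * d * Cst d a) (CJ d a) (Cst d a) (CdeltaR o d a α (theta0 d α (betaNE3 o C))))
      (C4F o d L a a' α β C) := by
    obtain ⟨j⟩ := hJ
    obtain ⟨h1, h2, -, -, -, -, -, -⟩ := smallness_of_le (o := o) (d := d) a ha.le ha' hα hβ hαη hβη hη
    have hP := perturbationLaws_balaban_final L M a ha hd (hreg j) hC (hNE3 j) ha' h1 h2
    have h0 := (norm_nonneg _).trans (hP.consistent_le 0)
    simpa using h0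
  subst hδ
  exact ne5_at_of_towerLaw_lip_readsIns_nat Mdl Ins hr (towerContracting_perturbed (freeTowerLaws_king_kron L M a ha o)) hlaw hread hcR
    (Cpert_nonneg ht hC₀ (CJ_nonneg d a) hC₂ le_rfl) hfl hr₀ hrA hrB hbase hlip hdA hdB hreadI hienv hbdA hGi hρ₁ hreach hdamp hΛ
    (inv_pos.mpr hL) hθθ' hθ'1 hc hω hnear hBc hfirst hsmall

end EndFace

/-! ## §4 The family indexed by the admissible data of node NE3's carrier -/

section Carrier

variable {𝒞 : ℕ → Set (B7Prop1Explicit.Site d → Fin d → (Matrix o o ℂ)ˣ)} {N : ℕ}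
  {dom : Set (B7Prop1Explicit.Site d → Fin d → (Matrix o o ℂ)ˣ)}
  {Rg : (B7Prop1Explicit.Site d → Fin d → (Matrix o o ℂ)ˣ) → ((k : ℕ) → Fin d → (Tor (fine (lev L k) M) → Matrix o o ℂ))}
  {α β C θ a' η : ℝ}

/-- **ROW NE5's W1 LAW FOR BAŁABAN's TYPED TIER-B OPERATOR, THE FAMILY = THE ADMISSIBLE DATA OF NODE NE3's CARRIER** (`d ≥ 1`): for a
datum-indexed family `Rg : V ↦ (k ↦ R_k)` of site-based transporter towers (DATA, no B0) with `RegularTransporters (liftR (Rg V)) α β` for every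
`V ∈ dom`, ONE NE3-type binder — node U1b's `LocalRate … C θ` on `MinimalActionRate.minActReadings d 𝒞 L N dom (ne2Loc L M (liftR ∘ Rg))` (the NE3
lineage's carrier with the NE2 reading; OPEN, displayed; `0 ≤ θ ≤ L⁻¹`) —, `a′ > 0`, `α, β ≤ η ≤ etaStar o d a a′`:
`TowerLaw (fun _ : ↥dom => (Q_L ⊗ 1)) (pertTower (Δ_a ⊗ 1) (fun V => P(Rg V)) 1) L^d (Cpert κ_B (2dCst) CJ C₂^B 0 1) L⁻¹` — §2 with
`hNE3 V := NE2BalabanFromNE3.localRate_regClass_of_minActReadings` (row B6′).  The END face follows from §3 with `Jx := ↥dom`.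
NE5 / NE2 / NE3 NOT proved. [folklore] -/
theorem towerLaw_balaban_final_of_minActReadings (hd : 1 ≤ d) (hreg : ∀ V ∈ dom, RegularTransporters L M (liftR L M (Rg V)) α β)
    (hα : 0 ≤ α) (hβ : 0 ≤ β) (hC : 0 ≤ C) (hθ0 : 0 ≤ θ) (hθL : θ ≤ (L : ℝ)⁻¹)
    (hNE3 : LocalRate (minActReadings d 𝒞 L N dom (ne2Loc L M fun V => liftR L M (Rg V))) C θ) (ha' : 0 < a')
    (hαη : α ≤ η) (hβη : β ≤ η) (hη : η ≤ etaStar o d a a') :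
    TowerLaw (fun _ : ↥dom => fun k => Qlev L M k ⊗ₖ (1 : Matrix o o ℂ))
      (pertTower (fun k => calDalev L M a ha k ⊗ₖ (1 : Matrix o o ℂ))
        (fun V : ↥dom => balabanPert L M a (liftR L M (Rg V)) (gaugeSlot L M (Rg V) (QuT L M o (siteT L M (Rg V))) (Q1 L M o) a')) 1)
      ((L : ℝ) ^ d)
      (Cpert (kappaBs o d a α β (a * (epsR o d α * (2 + epsR o d α) * Cst d a)) (kappa4F d a a' α β))
        (2 * d * Cst d a) (CJ d a)
        (C2Bs o d L a α β C
          (a * C2gram (Cst d a) 1 (epsR o d α) (2 * d * Cst d a) (CJ d a) (Cst d a) (CdeltaR o d a α (theta0 d α (betaNE3 o C))))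
          (C4F o d L a a' α β C)) 0 1) ((L : ℝ)⁻¹) :=
  towerLaw_balaban_final_of_regular L M a ha (Rg := fun V : ↥dom => Rg V) hd (fun V => hreg V V.2) hα hβ hC
    (fun V => localRate_regClass_of_minActReadings L M hC hθ0 hθL hNE3 V.2) ha' hαη hβη hη

end Carrier

/-! ## §5 Row NE5's W1 «NE2 ∧ NE3» split face with ONE hypothesis on NE3's carrier feeding both legs -/

section Split

variable {𝒞 : ℕ → Set (B7Prop1Explicit.Site d → Fin d → (Matrix o o ℂ)ˣ)} {N : ℕ}
  {dom : Set (B7Prop1Explicit.Site d → Fin d → (Matrix o o ℂ)ˣ)}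
  {Rg : (B7Prop1Explicit.Site d → Fin d → (Matrix o o ℂ)ˣ) → ((k : ℕ) → Fin d → (Tor (fine (lev L k) M) → Matrix o o ℂ))}
  {α β C a' η : ℝ}
variable {Cr : Carriers} {Op Hist : Type*} [NormedAddCommGroup Op] [NormedSpace ℂ Op] [NormedAddCommGroup Hist]
  [NormedSpace ℂ Hist] (Mdl : StepModel Cr Op Hist)

/-- **ROW NE5's OPERATOR RATE (W1) FOR BAŁABAN's TYPED TIER-B OPERATOR BY THE MINIMISER SPLIT, ONE NE3-TYPE HYPOTHESIS FEEDING BOTH LEGS**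
(`d ≥ 1`, `dom` nonempty): first leg = §4's `TowerLaw` (rate `L⁻¹`) read on the pair (run A, `opMid`) (`ReadsTowerMid`, constant `cR`, margin floor
`r₀`); second leg = operator Lipschitz in the background (`Λb·dist·rOp`) × the minimiser distance dominated by ONE site-reading discrepancy (`hdom`) of
THE SAME carrier `minActReadings d 𝒞 L N dom (ne2Loc L M (liftR ∘ Rg))` whose `LocalRate … C L⁻¹` (`hNE3`, node U1b's shape, OPEN, displayed) also
feeds the first leg ⟹ `OperatorRate W (cR·Cpert(κ_B, 2dCst, CJ, C₂^B, 0, 1)/r₀ + Λb·C) L⁻¹` — the socket's `operatorRate_of_towerLaw_split` BY NAME.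
Row NE5's END faces (`ne5_at_of_towerLaw_split_*`) consume exactly this `OperatorRate`.  NE5 / NE2 / NE3 NOT proved; `Rg` DATA (no B0). [folklore] -/
theorem operatorRate_of_balaban_split_minActReadings (hne : dom.Nonempty) (hd : 1 ≤ d)
    (hreg : ∀ V ∈ dom, RegularTransporters L M (liftR L M (Rg V)) α β) (hα : 0 ≤ α) (hβ : 0 ≤ β) (hC : 0 ≤ C)
    (hNE3 : LocalRate (minActReadings d 𝒞 L N dom (ne2Loc L M fun V => liftR L M (Rg V))) C ((L : ℝ)⁻¹)) (ha' : 0 < a')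
    (hαη : α ≤ η) (hβη : β ≤ η) (hη : η ≤ etaStar o d a a')
    {W : Set (ℕ → ℝ)} {cR r₀ Λb : ℝ} {tow : ℕ → (ℕ → ℝ) → Cr.BgB → ↥dom} (opMid : (ℕ → ℝ) → Cr.BgB → ℕ → Op)
    (dist : ℕ → (ℕ → ℝ) → Cr.BgB → ℝ)
    (hread : ReadsTowerMid Mdl (fun _ : ↥dom => fun k => Qlev L M k ⊗ₖ (1 : Matrix o o ℂ))
      (pertTower (fun k => calDalev L M a ha k ⊗ₖ (1 : Matrix o o ℂ))
        (fun V : ↥dom => balabanPert L M a (liftR L M (Rg V)) (gaugeSlot L M (Rg V) (QuT L M o (siteT L M (Rg V))) (Q1 L M o) a')) 1)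
      ((L : ℝ) ^ d) W cR tow opMid)
    (hcR : 0 ≤ cR) (hfl : ∀ k, r₀ ≤ Mdl.rOp k) (hr₀ : 0 < r₀)
    (hLip : ∀ k, ∀ g ∈ W, ∀ (U : Cr.BgB), ‖opMid g U k - Mdl.opB g U k‖ ≤ Λb * dist k g U * Mdl.rOp k) (hΛb : 0 ≤ Λb)
    (hdom : ∀ k, ∀ g ∈ W, ∀ (U : Cr.BgB), ∃ V ∈ dom, ∃ x : Bool × NE2FromNE3.Site L M o,
      dist k g U ≤ |ne2Loc L M (fun V => liftR L M (Rg V)) (k + 1) V x - ne2Loc L M (fun V => liftR L M (Rg V)) k V x|) :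
    Mdl.OperatorRate W
      (cR * Cpert (kappaBs o d a α β (a * (epsR o d α * (2 + epsR o d α) * Cst d a)) (kappa4F d a a' α β))
        (2 * d * Cst d a) (CJ d a)
        (C2Bs o d L a α β C
          (a * C2gram (Cst d a) 1 (epsR o d α) (2 * d * Cst d a) (CJ d a) (Cst d a) (CdeltaR o d a α (theta0 d α (betaNE3 o C))))
          (C4F o d L a a' α β C)) 0 1 / r₀ + Λb * C) ((L : ℝ)⁻¹) := by
  have hL : (0 : ℝ) < L := by exact_mod_cast Nat.pos_of_ne_zero (NeZero.ne L)
  have hr : (0 : ℝ) < (L : ℝ) ^ d := pow_pos hL d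
  have ht := norm_one_mul_kappaBs_lt_one_of_regular (o := o) (d := d) a ha.le ha' hα hβ hαη hβη hη
  have hC₀ : (0 : ℝ) ≤ 2 * d * Cst d a := by have := Cst_nonneg d a; positivity
  have hC₂ : 0 ≤ C2Bs o d L a α β C
      (a * C2gram (Cst d a) 1 (epsR o d α) (2 * d * Cst d a) (CJ d a) (Cst d a) (CdeltaR o d a α (theta0 d α (betaNE3 o C))))
      (C4F o d L a a' α β C) := by
    obtain ⟨V₀, hV₀⟩ := hne
    obtain ⟨h1, h2, -, -, -, -, -, -⟩ := smallness_of_le (o := o) (d := d) a ha.le ha' hα hβ hαη hβη hη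
    have hP := perturbationLaws_balaban_final L M a ha hd (hreg V₀ hV₀) hC
      (localRate_regClass_of_minActReadings L M hC (inv_nonneg.mpr hL.le) le_rfl hNE3 hV₀) ha' h1 h2
    have h0 := (norm_nonneg _).trans (hP.consistent_le 0)
    simpa using h0
  exact operatorRate_of_towerLaw_split Mdl opMid dist (minActReadings d 𝒞 L N dom (ne2Loc L M fun V => liftR L M (Rg V))) hr
    (towerContracting_perturbed (freeTowerLaws_king_kron L M a ha o))
    (towerLaw_balaban_final_of_minActReadings L M a ha hd hreg hα hβ hC (inv_nonneg.mpr hL.le) le_rfl hNE3 ha' hαη hβη hη)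
    hread hcR (Cpert_nonneg ht hC₀ (CJ_nonneg d a) hC₂ le_rfl) (inv_nonneg.mpr hL.le) le_rfl hfl hr₀ hLip hΛb hNE3 hdom

end Split

end Summit.QuantumFields.BalabanUV.T4Continuum.OutputRateTowerBalaban

end
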